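import Mathlib
import HarnessLib

/-!
# Real-variable Vitali propagation (`stub_realVitali`)

Line `temperature-blind-vitali-hurwitz` of crux `EmbeddedDrudeMourre.GreenKuboContinuation`
(item `stmt-AtomisticToContinuum-12597`), registered stub `stub_realVitali` — the pure-analysis
consumer of the line, proved here with exactly the registered signature.

**Statement.** Let `g ν : ℝ → ℝ` (`ν ∈ (0,1]`) be smooth on `(0,∞)` (every global
`iteratedDeriv k (g ν)` is differentiable on `Ioi 0`) with, on every `[a,b] ⊂ (0,∞)`, `ν`-uniform
factorial bounds `|g_ν^{(k)}| ≤ C^{k+1} k!` for all `k ≥ 1`. If `g_ν(T)` converges as `ν ↓ 0` for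
every `T ∈ (0,T₀)`, then it converges for every `T > 0`.

**Proof (purely real; no complexification, no Montel/Vitali).** Convergence as `ν ↓ 0` is
transported along the `T`-axis in steps of length `1/(2C)` by two elementary devices:
* `exists_tendsto_of_forall_approx` — a real family which is, for every `ε > 0`, eventually
  `ε`-close to SOME convergent family, converges (Cauchy criterion / Moore–Osgood);
* `abs_sub_taylor_sum_le` — Taylor's formula with Lagrange remainder in the GLOBAL `iteratedDeriv`
  (Mathlib's `taylor_mean_remainder_lagrange_iteratedDeriv`, the Taylor polynomial rewritten with
  `iteratedDerivWithin_eq_iteratedDeriv`).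
With these: (i) convergence of `g_ν` on an interval `(a, c]` gives convergence of every
derivative `g_ν^{(k)}` on `(a, c]` (`tendsto_iteratedDeriv_of_tendsto`: the backward difference
quotient of `g_ν^{(k)}` with step `h` converges and is `C^{k+3}(k+2)!·h`-close to `g_ν^{(k+1)}`,
uniformly in `ν`); (ii) convergence of all `g_ν^{(k)}(c)` gives convergence of `g_ν(S)` for
`|S - c| ≤ 1/(2C)` (`tendsto_of_tendsto_iteratedDeriv`: the Taylor polynomials at `c` converge
and are `C·2^{-(N+1)}`-close to `g_ν(S)`, uniformly in `ν`); (iii) induction on the number of steps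
from the seed interval `[T₀/4, T₀/2] ⊂ (0, T₀)` inside the compact `[T₀/4, T+1]`.
Everything is standard real analysis and tagged folklore.
-/

noncomputable section

namespace Summit.AtomisticToContinuum.FouriersLaw.Theorems.GreenKuboContinuation.TemperatureBlindVitaliHurwitz

open Filter Topology Set
open scoped Nat

/-! ## Two elementary devices -/

/-- **Approximation principle** (Cauchy criterion / Moore–Osgood): a real family which is, for
every `ε > 0`, eventually `ε`-close to some convergent family, converges. [folklore] -/
theorem exists_tendsto_of_forall_approx {α : Type*} {l : Filter α} [l.NeBot] {x : α → ℝ}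
    (h : ∀ ε : ℝ, 0 < ε →
      ∃ y : α → ℝ, (∃ L : ℝ, Tendsto y l (𝓝 L)) ∧ ∀ᶠ ν in l, |x ν - y ν| ≤ ε) :
    ∃ L : ℝ, Tendsto x l (𝓝 L) := by
  rw [← cauchy_map_iff_exists_tendsto, Metric.cauchy_iff]
  refine ⟨inferInstance, fun ε hε => ?_⟩
  obtain ⟨y, ⟨L, hL⟩, hxy⟩ := h (ε / 4) (by positivity)
  have hyL : ∀ᶠ ν in l, dist (y ν) L < ε / 4 := Metric.tendsto_nhds.1 hL _ (by positivity)
  refine ⟨Metric.ball L (ε / 2), ?_, fun u hu v hv => ?_⟩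
  · show ∀ᶠ ν in l, x ν ∈ Metric.ball L (ε / 2)
    filter_upwards [hxy, hyL] with ν h1 h2
    rw [Metric.mem_ball, Real.dist_eq]
    rw [Real.dist_eq] at h2
    calc |x ν - L| ≤ |x ν - y ν| + |y ν - L| := abs_sub_le _ _ _
      _ < ε / 2 := by linarith
  · rw [Metric.mem_ball] at hu hv
    calc dist u v ≤ dist u L + dist v L := dist_triangle_right _ _ _
      _ < ε := by linarith

/-- Smoothness on `(0,∞)` in the form used by the skeleton (every global `iteratedDeriv` is
differentiable on `Ioi 0`) gives `ContDiffOn` of every order on `Ioi 0`. [folklore] -/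
theorem contDiffOn_Ioi_of_differentiableOn_iteratedDeriv {f : ℝ → ℝ}
    (hf : ∀ k : ℕ, DifferentiableOn ℝ (iteratedDeriv k f) (Ioi 0)) (n : ℕ∞) :
    ContDiffOn ℝ n f (Ioi 0) :=
  contDiffOn_of_differentiableOn_deriv fun m _ =>
    (hf m).congr fun _ hx => iteratedDerivWithin_of_isOpen isOpen_Ioi hx

/-- Iterating `iteratedDeriv`: `(f^{(k)})^{(j)} = f^{(k+j)}`. [folklore] -/
theorem iteratedDeriv_iteratedDeriv (f : ℝ → ℝ) (j k : ℕ) :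
    iteratedDeriv j (iteratedDeriv k f) = iteratedDeriv (k + j) f := by
  rw [iteratedDeriv_eq_iterate, iteratedDeriv_eq_iterate, iteratedDeriv_eq_iterate,
    ← Function.iterate_add_apply, Nat.add_comm]

/-- **Taylor's formula with Lagrange remainder, global derivatives.** For `f` smooth on `(0,∞)`
and `x₀, x ∈ [a,b] ⊂ (0,∞)`:
`|f x - ∑_{k ≤ n} f^{(k)}(x₀) (x - x₀)^k / k!| ≤ M |x - x₀|^{n+1} / (n+1)!`
whenever `|f^{(n+1)}| ≤ M` on `[a,b]`. [folklore] -/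
theorem abs_sub_taylor_sum_le {f : ℝ → ℝ} {a b M x₀ x : ℝ} {n : ℕ} (ha : 0 < a)
    (hf : ∀ k : ℕ, DifferentiableOn ℝ (iteratedDeriv k f) (Ioi 0))
    (hM : ∀ y ∈ Icc a b, |iteratedDeriv (n + 1) f y| ≤ M)
    (hx₀ : x₀ ∈ Icc a b) (hx : x ∈ Icc a b) :
    |f x - ∑ k ∈ Finset.range (n + 1), iteratedDeriv k f x₀ / (k ! : ℝ) * (x - x₀) ^ k| ≤
      M * |x - x₀| ^ (n + 1) / ((n + 1)! : ℝ) := by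
  rcases eq_or_ne x₀ x with rfl | hne
  · simp [Finset.sum_range_succ']
  have hcd : ContDiffOn ℝ (n + 1) f (uIcc x₀ x) := by
    have h := (contDiffOn_Ioi_of_differentiableOn_iteratedDeriv hf ((n + 1 : ℕ) : ℕ∞)).mono
      ((uIcc_subset_Icc hx₀ hx).trans fun y hy => ha.trans_le hy.1)
    exact_mod_cast h
  obtain ⟨ξ, hξ, hrem⟩ := taylor_mean_remainder_lagrange_iteratedDeriv hne hcd
  have hpoly : taylorWithinEval f n (uIcc x₀ x) x₀ x =
      ∑ k ∈ Finset.range (n + 1), iteratedDeriv k f x₀ / (k ! : ℝ) * (x - x₀) ^ k := by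
    rw [taylor_within_apply]
    refine Finset.sum_congr rfl fun k _ => ?_
    have hu : UniqueDiffOn ℝ (uIcc x₀ x) := uniqueDiffOn_Icc (inf_lt_sup.2 hne)
    rw [iteratedDerivWithin_eq_iteratedDeriv hu
      ((contDiffOn_Ioi_of_differentiableOn_iteratedDeriv hf k).contDiffAt
        (Ioi_mem_nhds (ha.trans_le hx₀.1))) left_mem_uIcc, smul_eq_mul]
    ring
  have hξ' : ξ ∈ Icc a b := uIcc_subset_Icc hx₀ hx ⟨hξ.1.le, hξ.2.le⟩
  rw [← hpoly, hrem, abs_div, abs_mul, abs_pow, Nat.abs_cast]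
  gcongr
  exact hM ξ hξ'

/-! ## The family: derivative step and Taylor step -/

section Family

variable {g : ℝ → ℝ → ℝ} {a b C c : ℝ}

/-- **Taylor step.** If every derivative `g_ν^{(k)}(c)` converges as `ν ↓ 0`, then `g_ν(S)`
converges for every `S ∈ [a,b]` with `|S - c| ≤ 1/(2C)` (the Taylor polynomials at `c` converge
and approximate `g_ν(S)` within `C 2^{-(N+1)}` uniformly in `ν`). [folklore] -/
theorem tendsto_of_tendsto_iteratedDeriv (ha : 0 < a) (hC : 0 < C)
    (hdiff : ∀ ν : ℝ, 0 < ν → ν ≤ 1 → ∀ k : ℕ, DifferentiableOn ℝ (iteratedDeriv k (g ν)) (Ioi 0))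
    (hbnd : ∀ ν : ℝ, 0 < ν → ν ≤ 1 → ∀ k : ℕ, 1 ≤ k → ∀ T ∈ Icc a b,
      |iteratedDeriv k (g ν) T| ≤ C ^ (k + 1) * (k ! : ℝ))
    (hc : c ∈ Icc a b)
    (hconv : ∀ k : ℕ, ∃ L : ℝ, Tendsto (fun ν => iteratedDeriv k (g ν) c) (𝓝[>] 0) (𝓝 L))
    {S : ℝ} (hS : S ∈ Icc a b) (hSc : |S - c| ≤ 1 / (2 * C)) :
    ∃ L : ℝ, Tendsto (fun ν => g ν S) (𝓝[>] 0) (𝓝 L) := by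
  refine exists_tendsto_of_forall_approx fun ε hε => ?_
  obtain ⟨N, hN⟩ :=
    exists_pow_lt_of_lt_one (show 0 < ε / C by positivity) (by norm_num : (1 / 2 : ℝ) < 1)
  choose L hL using hconv
  refine ⟨fun ν => ∑ k ∈ Finset.range (N + 1), iteratedDeriv k (g ν) c / (k ! : ℝ) * (S - c) ^ k,
    ⟨∑ k ∈ Finset.range (N + 1), L k / (k ! : ℝ) * (S - c) ^ k,
      tendsto_finsetSum _ fun k _ => ((hL k).div_const _).mul_const _⟩, ?_⟩
  filter_upwards [Ioc_mem_nhdsGT zero_lt_one] with ν hν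
  have hM : ∀ y ∈ Icc a b, |iteratedDeriv (N + 1) (g ν) y| ≤ C ^ (N + 1 + 1) * ((N + 1)! : ℝ) :=
    fun y hy => hbnd ν hν.1 hν.2 (N + 1) (by omega) y hy
  have hCS : C * |S - c| ≤ 1 / 2 :=
    calc C * |S - c| ≤ C * (1 / (2 * C)) := by gcongr
      _ = 1 / 2 := by field_simp
  have hfac : ((N + 1)! : ℝ) ≠ 0 := by positivity
  calc |g ν S - ∑ k ∈ Finset.range (N + 1), iteratedDeriv k (g ν) c / (k ! : ℝ) * (S - c) ^ k|
      ≤ C ^ (N + 1 + 1) * ((N + 1)! : ℝ) * |S - c| ^ (N + 1) / ((N + 1)! : ℝ) :=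
        abs_sub_taylor_sum_le ha (hdiff ν hν.1 hν.2) hM hc hS
    _ = C * (C * |S - c|) ^ (N + 1) := by
        field_simp
        ring
    _ ≤ C * (1 / 2) ^ (N + 1) := by gcongr
    _ ≤ C * (1 / 2) ^ N := by
        have h2 : (1 / 2 : ℝ) ^ (N + 1) ≤ (1 / 2) ^ N :=
          pow_le_pow_of_le_one (by norm_num) (by norm_num) (Nat.le_succ N)
        exact mul_le_mul_of_nonneg_left h2 hC.le
    _ ≤ ε := by
        rw [lt_div_iff₀ hC] at hN
        linarith

/-- **Derivative step.** Convergence of `g_ν^{(k)}` as `ν ↓ 0` on `(a, c]` (`c ≤ b`) gives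
convergence of `g_ν^{(k+1)}` on `(a, c]`: the backward difference quotient of `g_ν^{(k)}` with
step `h` converges and is `C^{k+3}(k+2)!·h`-close to `g_ν^{(k+1)}`, uniformly in `ν`. [folklore] -/
theorem tendsto_iteratedDeriv_succ (ha : 0 < a) (hC : 0 < C)
    (hdiff : ∀ ν : ℝ, 0 < ν → ν ≤ 1 → ∀ k : ℕ, DifferentiableOn ℝ (iteratedDeriv k (g ν)) (Ioi 0))
    (hbnd : ∀ ν : ℝ, 0 < ν → ν ≤ 1 → ∀ k : ℕ, 1 ≤ k → ∀ T ∈ Icc a b,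
      |iteratedDeriv k (g ν) T| ≤ C ^ (k + 1) * (k ! : ℝ))
    (hcb : c ≤ b) {k : ℕ}
    (hconv : ∀ S ∈ Ioc a c,
      ∃ L : ℝ, Tendsto (fun ν => iteratedDeriv k (g ν) S) (𝓝[>] 0) (𝓝 L))
    {S : ℝ} (hS : S ∈ Ioc a c) :
    ∃ L : ℝ, Tendsto (fun ν => iteratedDeriv (k + 1) (g ν) S) (𝓝[>] 0) (𝓝 L) := by
  refine exists_tendsto_of_forall_approx fun ε hε => ?_
  set K : ℝ := C ^ (k + 2 + 1) * ((k + 2)! : ℝ) with hK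
  have hK0 : 0 < K := by positivity
  have hSa : 0 < S - a := sub_pos.2 hS.1
  set h : ℝ := min ((S - a) / 2) (ε / K) with hh
  have hh0 : 0 < h := lt_min (by positivity) (by positivity)
  have hha : h < S - a := (min_le_left _ _).trans_lt (by linarith)
  have hhε : K * h ≤ ε :=
    calc K * h ≤ K * (ε / K) := by gcongr; exact min_le_right _ _
      _ = ε := by field_simp
  have hSab : S ∈ Icc a b := ⟨hS.1.le, hS.2.trans hcb⟩
  have hShab : S - h ∈ Icc a b := ⟨by linarith, by linarith [hS.2]⟩
  obtain ⟨L₁, hL₁⟩ := hconv S hS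
  obtain ⟨L₂, hL₂⟩ := hconv (S - h) ⟨by linarith, by linarith [hS.2]⟩
  refine ⟨fun ν => (iteratedDeriv k (g ν) S - iteratedDeriv k (g ν) (S - h)) / h,
    ⟨(L₁ - L₂) / h, (hL₁.sub hL₂).div_const h⟩, ?_⟩
  filter_upwards [Ioc_mem_nhdsGT zero_lt_one] with ν hν
  -- Taylor of order one for `φ := g_ν^{(k)}` at `S`, evaluated at `S - h`
  have hφ : ∀ j : ℕ, DifferentiableOn ℝ (iteratedDeriv j (iteratedDeriv k (g ν))) (Ioi 0) :=
    fun j => by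
      rw [iteratedDeriv_iteratedDeriv]
      exact hdiff ν hν.1 hν.2 _
  have hM : ∀ y ∈ Icc a b, |iteratedDeriv (1 + 1) (iteratedDeriv k (g ν)) y| ≤ K := fun y hy => by
    rw [iteratedDeriv_iteratedDeriv]
    exact hbnd ν hν.1 hν.2 (k + 2) (by omega) y hy
  have key := abs_sub_taylor_sum_le (n := 1) ha hφ hM hSab hShab
  have hsum : ∑ j ∈ Finset.range (1 + 1),
      iteratedDeriv j (iteratedDeriv k (g ν)) S / (j ! : ℝ) * (S - h - S) ^ j =
        iteratedDeriv k (g ν) S - iteratedDeriv (k + 1) (g ν) S * h := by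
    rw [Finset.sum_range_succ, Finset.sum_range_one, iteratedDeriv_zero, iteratedDeriv_one,
      ← iteratedDeriv_succ]
    simp [Nat.factorial]
    ring
  have hrhs : K * |S - h - S| ^ (1 + 1) / ((1 + 1)! : ℝ) = K * h ^ 2 / 2 := by
    rw [show S - h - S = -h by ring, abs_neg, abs_of_pos hh0]
    norm_num [Nat.factorial]
  rw [hsum, hrhs] at key
  have hid : iteratedDeriv (k + 1) (g ν) S -
      (iteratedDeriv k (g ν) S - iteratedDeriv k (g ν) (S - h)) / h =
        (iteratedDeriv k (g ν) (S - h) -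
          (iteratedDeriv k (g ν) S - iteratedDeriv (k + 1) (g ν) S * h)) / h := by
    field_simp
    ring
  rw [hid, abs_div, abs_of_pos hh0, div_le_iff₀ hh0]
  calc _ ≤ K * h ^ 2 / 2 := key
    _ ≤ ε * h := by
        nlinarith [mul_nonneg hK0.le (sq_nonneg h), mul_le_mul_of_nonneg_right hhε hh0.le]

/-- All derivatives `g_ν^{(k)}` converge as `ν ↓ 0` on `(a, c]` (`c ≤ b`) as soon as the
functions `g_ν` do (induction on `k` with `tendsto_iteratedDeriv_succ`). [folklore] -/
theorem tendsto_iteratedDeriv_of_tendsto (ha : 0 < a) (hC : 0 < C)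
    (hdiff : ∀ ν : ℝ, 0 < ν → ν ≤ 1 → ∀ k : ℕ, DifferentiableOn ℝ (iteratedDeriv k (g ν)) (Ioi 0))
    (hbnd : ∀ ν : ℝ, 0 < ν → ν ≤ 1 → ∀ k : ℕ, 1 ≤ k → ∀ T ∈ Icc a b,
      |iteratedDeriv k (g ν) T| ≤ C ^ (k + 1) * (k ! : ℝ))
    (hcb : c ≤ b)
    (hconv : ∀ S ∈ Ioc a c, ∃ L : ℝ, Tendsto (fun ν => g ν S) (𝓝[>] 0) (𝓝 L)) (k : ℕ) :
    ∀ S ∈ Ioc a c, ∃ L : ℝ, Tendsto (fun ν => iteratedDeriv k (g ν) S) (𝓝[>] 0) (𝓝 L) := by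
  induction k with
  | zero => simpa only [iteratedDeriv_zero] using hconv
  | succ k ih => exact fun S hS => tendsto_iteratedDeriv_succ ha hC hdiff hbnd hcb ih hS

end Family

/-! ## The registered stub -/

/-- **Stub 5 of the line `temperature-blind-vitali-hurwitz` — REAL-VARIABLE VITALI PROPAGATION**
(pure analysis; the card's First lemma `RealVitaliPropagation` in filter form and relative shape).
Let `g ν : ℝ → ℝ` (`ν ∈ (0,1]`) be `C^∞` on `(0,∞)` with, on every `[a,b] ⊂ (0,∞)`, a `ν`-uniform
bound `|g_ν^{(k)}| ≤ C^{k+1} k!` for all `k ≥ 1`; if `g_ν(T)` converges as `ν ↓ 0` for every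
`T ∈ (0, T₀)`, then it converges for every `T > 0`. Proof: for `T ≥ T₀` work in `[T₀/4, T+1]`
with its constant `C`; by induction on `m`, `g_ν(S)` converges for all `S` in
`[T₀/4, T+1] ∩ (-∞, T₀/2 + m/(2C)]` (`m = 0`: the seed; step: all derivatives converge at the
centre `c = T₀/2 + m/(2C)` by `tendsto_iteratedDeriv_of_tendsto`, then the Taylor step
`tendsto_of_tendsto_iteratedDeriv` reaches `c + 1/(2C)`); Archimedes ends the induction at `T`.
Without the factorial clause the statement is false (`2 + expNegInvGlue (T-1) · sin (log ν)`).
[folklore] -/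
theorem stub_realVitali :
    ∀ (g : ℝ → ℝ → ℝ) (T₀ : ℝ), 0 < T₀ →
      (∀ ν : ℝ, 0 < ν → ν ≤ 1 → ∀ k : ℕ, DifferentiableOn ℝ (iteratedDeriv k (g ν)) (Set.Ioi 0)) →
      (∀ a b : ℝ, 0 < a → a < b → ∃ C : ℝ, 0 < C ∧ ∀ ν : ℝ, 0 < ν → ν ≤ 1 →
        ∀ k : ℕ, 1 ≤ k → ∀ T ∈ Set.Icc a b,
          |iteratedDeriv k (g ν) T| ≤ C ^ (k + 1) * (k.factorial : ℝ)) →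
      (∀ T : ℝ, 0 < T → T < T₀ →
        ∃ L : ℝ, Filter.Tendsto (fun ν : ℝ => g ν T) (nhdsWithin (0:ℝ) (Set.Ioi 0)) (nhds L)) →
      ∀ T : ℝ, 0 < T →
        ∃ L : ℝ, Filter.Tendsto (fun ν : ℝ => g ν T) (nhdsWithin (0:ℝ) (Set.Ioi 0)) (nhds L) := by
  intro g T₀ hT₀ hdiff hbnd hseed T hT
  by_cases hTT₀ : T < T₀
  · exact hseed T hT hTT₀
  push Not at hTT₀
  obtain ⟨C, hC, hbC⟩ := hbnd (T₀ / 4) (T + 1) (by positivity) (by linarith)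
  have hρ : 0 < 1 / (2 * C) := by positivity
  -- stepping: convergence on `[T₀/4, T+1] ∩ (-∞, T₀/2 + m/(2C)]` by induction on `m`
  have key : ∀ m : ℕ, ∀ S ∈ Icc (T₀ / 4) (T + 1), S ≤ T₀ / 2 + m * (1 / (2 * C)) →
      ∃ L : ℝ, Tendsto (fun ν => g ν S) (𝓝[>] 0) (𝓝 L) := by
    intro m
    induction m with
    | zero =>
      intro S hS hSm
      rw [Nat.cast_zero, zero_mul, add_zero] at hSm
      exact hseed S (by linarith [hS.1]) (by linarith)
    | succ m ih =>
      intro S hS hSm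
      by_cases hle : S ≤ T₀ / 2 + m * (1 / (2 * C))
      · exact ih S hS hle
      push Not at hle
      have hm0 : (0 : ℝ) ≤ m * (1 / (2 * C)) := by positivity
      have hc : T₀ / 2 + m * (1 / (2 * C)) ∈ Icc (T₀ / 4) (T + 1) :=
        ⟨by linarith, by linarith [hS.2]⟩
      have hac : T₀ / 4 < T₀ / 2 + m * (1 / (2 * C)) := by linarith
      have hall := tendsto_iteratedDeriv_of_tendsto (by positivity) hC hdiff hbC hc.2
        (fun S' hS' => ih S' ⟨hS'.1.le, hS'.2.trans hc.2⟩ hS'.2)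
      refine tendsto_of_tendsto_iteratedDeriv (by positivity) hC hdiff hbC hc
        (fun k => hall k _ ⟨hac, le_rfl⟩) hS ?_
      rw [abs_of_pos (sub_pos.2 hle)]
      push_cast at hSm
      linarith
  obtain ⟨m, hm⟩ := exists_nat_ge ((T - T₀ / 2) / (1 / (2 * C)))
  refine key m T ⟨by linarith, by linarith⟩ ?_
  rw [div_le_iff₀ hρ] at hm
  linarith

end Summit.AtomisticToContinuum.FouriersLaw.Theorems.GreenKuboContinuation.TemperatureBlindVitaliHurwitz
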